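import Literature.AnabelianGeometry.EtaleTheta.Discharge.Sec4BaseEquivOfTemperoids
import Literature.AnabelianGeometry.EtaleTheta.Discharge.Sec4GaloisSurjNatural

/-!
# [EtTh] Thm. 4.4 (i): T44-L09 `HodotCompatible` and T44-L09c `GaloisCompatible` for settings whose base category
# EMBEDS in the temperoid `B^temp(Π^tp_X)` (e.g. print's `D = B^temp(Π^tp_X)⁰`), modulo the extension of `Ψ^bs`

S. Mochizuki, *The étale theta function and its Frobenioid-theoretic manifestations*, Publ. RIMS **45** (2009)
[MochizukiEtTh2009], Thm. 4.4 (i) p.320 (PDF p.94): «`Ψ^bs` induces an isomorphism `H_{⊙,1} ⥲ H_{⊙,2}`, which is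
well-defined up to composition with inner automorphisms of `Π^tp_{X_i}`»; proof p.321 (PDF p.95) ll.5–6: «The
portion of assertion (i) concerning `Ψ^bs` follows immediately from the theory of temperoids [cf. [SemiAnbd],
Proposition 3.2; Theorem A.4]».  Def. 3.6 (ii) p.302 (PDF p.76): the base `D` of a tempered Frobenioid is «a
connected, totally epimorphic category» — for the theta setting `D = B^temp(Π^tp_X)⁰`, the connected objects of
the temperoid (abc-iut-w4-d099's F-w4d099-1: the FULL `B^temp(Π)` is not totally epimorphic, so abc-iut-L2-t4's
genuine base is `ConnectedPart (BTemp X.Pi)`, `BiKummerSetting.mkOfConnectedTemperoid`).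
S. Mochizuki, *Semi-graphs of anabelioids*, Publ. RIMS **42** (2006) [MochizukiSemiAnbd2006], Prop. 3.2 p.35.

abc-iut cell, layer L2, ROW «SUBDAG-EtTh-Thm44 T44-L09 / T44-L09c AT THE TEMPEROID BASE via [SemiAnbd] Prop. 3.2»
(abc-iut-L2-lead gen 3 RULINGS #10; seat abc-iut-w5-d013 gen 3), FILE 2″ (repair of `Sec4Thm44GaloisCompatibleOfTemperoid`,
whose settings over the full `BTemp X.Pi` are vacuously parametrised).  SETTING: bi-Kummer settings `S₁`, `S₂` over
ARBITRARY bases `D₁`, `D₂` equipped with FAITHFUL functors `ιᵢ : Dᵢ ⥤ B^temp(Π^tp_{Xᵢ})` through which the Galois data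
are those of the temperoid (`hg₁`/`hI₂`/`hg₂`: Galois objects = those with Galois image, Galois surjections = gen 2's
`galoisSurjOf` on images — `⟨hA, fun _ => rfl⟩` / `id` at `mkOfConnectedTemperoid` with `ι` the full-subcategory
inclusion), ANY `h : Thm44Hyp S₁ S₂`, and ONE datum: an EXTENSION of the base equivalence `Ψ^bs : D₁ ≌ D₂` to the
temperoids, `E : B^temp(Π^tp_{X₁}) ≌ B^temp(Π^tp_{X₂})` with `Ψ^bs ⋙ ι₂ ≅ ι₁ ⋙ E` (for `D = B^temp(Π)⁰` this extension
EXISTS — countable coproduct completion `(B^temp(Π)⁰)^⊤ ⥲ B^temp(Π)`, [FrdI] §0 / [SemiAnbd] §3 — and is supplied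
by a separate file; here it is an explicit argument, never asserted).  RESULTS:
* `ker_galoisSurj_eq_of_map` — kernels of the setting's Galois surjections are the temperoid's `N_A`;
* `Thm44Hyp.isGalois_map_ofEmbedded` (`hG`), `Thm44Hyp.hodot_eq_comap_ofEmbedded` (`H_{⊙,2} = φ⁻¹ H_{⊙,1}` for the pin
  `E ≅ B^temp(φ)` of `BTemp.exists_res_iso_of_equivalence`), `Thm44Hyp.transportBaseAut_galoisSurj_ofEmbedded` (`hT`);
* **`Thm44Hyp.hodotCompatible_ofEmbedded : h.HodotCompatible`** (T44-L09) and
  **`Thm44Hyp.galoisCompatible_ofEmbedded : h.GaloisCompatible`** (T44-L09c), `preservesAmple_ofEmbedded` (T44-L08),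
  `thm44_i_ofEmbedded` (Thm. 4.4 (i) from «`C₂` Frobenioid» + T44-L03 + the extension datum).
Proof-only, no definition; nothing here bears on [IUTchIII] Cor. 3.12 (refereed pre-IUT material); typed ≠ proved
except for the theorems of this file.
-/

noncomputable section

namespace Literature.AnabelianGeometry.EtaleTheta

open CategoryTheory Opposite Literature.AlgebraicGeometry.Frobenioids Literature.AnabelianGeometry.SemiGraphs
  Literature.AnabelianGeometry.SemiGraphs.GaloisObjects

namespace BiKummerSetting

universe u₀ v₀ u v w

variable {K : Type u₀} [Field K] {K' : Type u₀} [Field K'] {X₁ : SemiGraphs.TemperedArithmeticGroup.{u₀} K}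
  {X₂ : SemiGraphs.TemperedArithmeticGroup.{u₀} K'} {D₀ : Type u₀} [Category.{v₀} D₀] {D₀' : Type u₀}
  [Category.{v₀} D₀'] {V : FrdIMonoidStub.{w}} {T₁ : RealifiedDivisorMonoids (D₀ := D₀) V}
  {T₂ : RealifiedDivisorMonoids (D₀ := D₀') V} {D₁ D₂ : Type u} [Category.{v} D₁] [Category.{v} D₂]
  {VD₁ : FrdICatStub.{u, v, w} D₁} {VD₂ : FrdICatStub.{u, v, w} D₂}
  {S₁ : BiKummerSetting X₁ T₁ D₁ VD₁} {S₂ : BiKummerSetting X₂ T₂ D₂ VD₂}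

/-! ### Kernels through a faithful functor to the temperoid -/

/-- **`Ker(Π^tp_X ↠ Aut_D(B)) = N_{ι B}`**: if the setting's Galois surjection at `B` maps, under a faithful
`ι : D ⥤ B^temp(Π^tp_X)`, to the temperoid's `galoisSurjOf` at `ι B`, the two kernels coincide (`ι` reflects
identities). [cite: MochizukiEtTh2009, Def 4.1 (ii) p.313 (PDF p.87)] -/
theorem ker_galoisSurj_eq_of_map {X : SemiGraphs.TemperedArithmeticGroup.{u₀} K} {T : RealifiedDivisorMonoids (D₀ := D₀) V}
    {D : Type u} [Category.{v} D] {VD : FrdICatStub.{u, v, w} D} (S : BiKummerSetting X T D VD)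
    (ι : D ⥤ BTemp X.Pi) [ι.Faithful] (B : D) (hB : S.IsGaloisObj B) (hB' : SemiGraphs.IsGaloisObj (ι.obj B))
    (e : ∀ g : X.Pi, ι.map (S.galoisSurj B hB g).hom = (galoisSurjOf X.isTempered (ι.obj B) hB' g).hom) :
    (S.galoisSurj B hB).ker = (galoisSurjOf X.isTempered (ι.obj B) hB').ker := by
  ext g
  simp only [MonoidHom.mem_ker]
  constructor
  · intro h1
    apply Iso.ext
    rw [← e g, h1]
    exact ι.map_id _
  · intro h2
    apply Iso.ext
    apply ι.map_injective
    rw [e g, h2]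
    exact (ι.map_id _).symm

section OfEmbedded

variable (ι₁ : D₁ ⥤ BTemp X₁.Pi) (ι₂ : D₂ ⥤ BTemp X₂.Pi)

/-! ### `hG`: `Ψ` preserves Galois objects -/

/-- **`Ψ(A)` is Galois for Galois `A`** (binder `hG`): `ι₂((Ψ A)^bs) ≅ ι₂(Ψ^bs(A^bs)) ≅ E(ι₁ A^bs) ≅ B^temp(φ)(ι₁ A^bs)`
and `B^temp(φ)` of a continuous surjection preserves Galois objects. [cite: MochizukiEtTh2009, Thm 4.4 (i) p.320 (PDF p.94)] -/
theorem Thm44Hyp.isGalois_map_ofEmbedded (h : Thm44Hyp S₁ S₂)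
    (hg₁ : ∀ (A : D₁) (hA : S₁.IsGaloisObj A), ∃ hA' : SemiGraphs.IsGaloisObj (ι₁.obj A),
      ∀ g : X₁.Pi, ι₁.map (S₁.galoisSurj A hA g).hom = (galoisSurjOf X₁.isTempered (ι₁.obj A) hA' g).hom)
    (hI₂ : ∀ B : D₂, SemiGraphs.IsGaloisObj (ι₂.obj B) → S₂.IsGaloisObj B)
    (E : BTemp X₁.Pi ≌ BTemp X₂.Pi) (ηE : h.Ψbs.functor ⋙ ι₂ ≅ ι₁ ⋙ E.functor)
    (A : S₁.C) (hA : S₁.IsGalois A) : S₂.IsGalois (h.Ψ.functor.obj A) := by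
  haveI := X₁.secondCountableTopology
  haveI := X₂.secondCountableTopology
  obtain ⟨φ, ψ, -, hφψ, ⟨iφ⟩, -⟩ := BTemp.exists_res_iso_of_equivalence X₁.isTempered X₂.isTempered E
  let η : h.Ψbs.functor ⋙ ι₂ ≅ ι₁ ⋙ BTemp.res φ := ηE ≪≫ Functor.isoWhiskerLeft ι₁ iφ
  obtain ⟨hA', -⟩ := hg₁ (S₁.base.obj A) hA
  let eA : ι₂.obj (S₂.base.obj (h.Ψ.functor.obj A)) ≅ (BTemp.res φ).obj (ι₁.obj (S₁.base.obj A)) :=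
    ι₂.mapIso (h.cmp A).symm ≪≫ η.app (S₁.base.obj A)
  exact hI₂ _ (isGaloisObj_of_iso X₂.isTempered eA
    (isGaloisObj_res X₁.isTempered φ (fun x => ⟨ψ x, hφψ x⟩) _ hA'))

/-! ### T44-L09: `H_{⊙,2} = φ⁻¹(H_{⊙,1})` -/

/-- **`H_{⊙,2} = φ⁻¹(H_{⊙,1})` ON THE NOSE** for the pin `E ≅ B^temp(φ)` (`φ` a continuous surjection) of an extension
`E` of `Ψ^bs`: both `H_{⊙,i}` are kernels `N_{ιᵢ A_{⊙,i}^bs}` (`ker_galoisSurj_eq_of_map`), `Ψ^bs(A_{⊙,1}^bs) ≅ A_{⊙,2}^bs`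
(`Thm44Hyp.mapsAodot`), kernels are invariant under isomorphism, and `N_{B^temp(φ)(A)} = φ⁻¹(N_A)` (gen 2's
`ker_galoisSurjOf_res`). [cite: MochizukiEtTh2009, Thm 4.4 (i) p.320 (PDF p.94)] -/
theorem Thm44Hyp.hodot_eq_comap_ofEmbedded [ι₁.Faithful] [ι₂.Faithful] (h : Thm44Hyp S₁ S₂)
    (hg₁ : ∀ (A : D₁) (hA : S₁.IsGaloisObj A), ∃ hA' : SemiGraphs.IsGaloisObj (ι₁.obj A),
      ∀ g : X₁.Pi, ι₁.map (S₁.galoisSurj A hA g).hom = (galoisSurjOf X₁.isTempered (ι₁.obj A) hA' g).hom)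
    (hg₂ : ∀ (B : D₂) (hB : S₂.IsGaloisObj B), ∃ hB' : SemiGraphs.IsGaloisObj (ι₂.obj B),
      ∀ g : X₂.Pi, ι₂.map (S₂.galoisSurj B hB g).hom = (galoisSurjOf X₂.isTempered (ι₂.obj B) hB' g).hom)
    (φ : X₂.Pi →ₜ* X₁.Pi) (hφ : Function.Surjective φ) (η : h.Ψbs.functor ⋙ ι₂ ≅ ι₁ ⋙ BTemp.res φ) :
    S₂.Hodot = S₁.Hodot.comap φ.toMonoidHom := by
  obtain ⟨h₁', e₁⟩ := hg₁ (S₁.base.obj S₁.Aodot) S₁.isGalois_Aodot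
  obtain ⟨h₂', e₂⟩ := hg₂ (S₂.base.obj S₂.Aodot) S₂.isGalois_Aodot
  obtain ⟨e⟩ := h.mapsAodot
  -- the component of `η` at `A_{⊙,1}^bs`, with objectwise types
  let ηA : ι₂.obj (h.Ψbs.functor.obj (S₁.base.obj S₁.Aodot)) ≅ (BTemp.res φ).obj (ι₁.obj (S₁.base.obj S₁.Aodot)) :=
    η.app (S₁.base.obj S₁.Aodot)
  have hFA : SemiGraphs.IsGaloisObj (ι₂.obj (h.Ψbs.functor.obj (S₁.base.obj S₁.Aodot))) :=
    isGaloisObj_of_iso X₂.isTempered ηA (isGaloisObj_res X₁.isTempered φ hφ _ h₁')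
  change (S₂.galoisSurj (S₂.base.obj S₂.Aodot) S₂.isGalois_Aodot).ker =
    (S₁.galoisSurj (S₁.base.obj S₁.Aodot) S₁.isGalois_Aodot).ker.comap φ.toMonoidHom
  rw [ker_galoisSurj_eq_of_map S₁ ι₁ _ _ h₁' e₁, ker_galoisSurj_eq_of_map S₂ ι₂ _ _ h₂' e₂,
    ker_galoisSurjOf_eq_of_iso X₂.isTempered (ι₂.mapIso e).symm h₂' hFA,
    ker_galoisSurjOf_eq_of_iso X₂.isTempered ηA hFA (isGaloisObj_res X₁.isTempered φ hφ _ h₁'),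
    ker_galoisSurjOf_res X₁.isTempered X₂.isTempered φ hφ _ h₁']

/-- **T44-L09 `HodotCompatible`** for settings over bases embedded in the temperoids, MODULO the extension `E` of `Ψ^bs`
(with `Ψ^bs ⋙ ι₂ ≅ ι₁ ⋙ E`): there is an isomorphism of topological groups `θ : Π^tp_{X₁} ⥲ Π^tp_{X₂}` with
`θ(H_{⊙,1}) = H_{⊙,2}` — `θ := φ⁻¹` for the pin `E ≅ B^temp(φ)` ([SemiAnbd] Prop. 3.2, `BTemp.exists_res_iso_of_equivalence`).
[cite: MochizukiEtTh2009, Thm 4.4 (i) p.320 (PDF p.94)] -/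
theorem Thm44Hyp.hodotCompatible_ofEmbedded [ι₁.Faithful] [ι₂.Faithful] (h : Thm44Hyp S₁ S₂)
    (hg₁ : ∀ (A : D₁) (hA : S₁.IsGaloisObj A), ∃ hA' : SemiGraphs.IsGaloisObj (ι₁.obj A),
      ∀ g : X₁.Pi, ι₁.map (S₁.galoisSurj A hA g).hom = (galoisSurjOf X₁.isTempered (ι₁.obj A) hA' g).hom)
    (hg₂ : ∀ (B : D₂) (hB : S₂.IsGaloisObj B), ∃ hB' : SemiGraphs.IsGaloisObj (ι₂.obj B),
      ∀ g : X₂.Pi, ι₂.map (S₂.galoisSurj B hB g).hom = (galoisSurjOf X₂.isTempered (ι₂.obj B) hB' g).hom)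
    (E : BTemp X₁.Pi ≌ BTemp X₂.Pi) (ηE : h.Ψbs.functor ⋙ ι₂ ≅ ι₁ ⋙ E.functor) : h.HodotCompatible := by
  haveI := X₁.secondCountableTopology
  haveI := X₂.secondCountableTopology
  obtain ⟨φ, ψ, hψφ, hφψ, ⟨iφ⟩, -⟩ := BTemp.exists_res_iso_of_equivalence X₁.isTempered X₂.isTempered E
  let η : h.Ψbs.functor ⋙ ι₂ ≅ ι₁ ⋙ BTemp.res φ := ηE ≪≫ Functor.isoWhiskerLeft ι₁ iφ
  let θ : X₁.Pi ≃ₜ* X₂.Pi :=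
    { toFun := ψ, invFun := φ, left_inv := hφψ, right_inv := hψφ, map_mul' := fun x y => map_mul ψ x y
      continuous_toFun := ψ.continuous, continuous_invFun := φ.continuous }
  have hθ : θ.toMulEquiv.symm.toMonoidHom = φ.toMonoidHom := MonoidHom.ext fun _ => rfl
  refine ⟨θ, ?_⟩
  rw [Subgroup.map_equiv_eq_comap_symm', hθ]
  exact (h.hodot_eq_comap_ofEmbedded ι₁ ι₂ hg₁ hg₂ φ (fun x => ⟨ψ x, hφψ x⟩) η).symm

/-! ### T44-L09c: the transport law and `GaloisCompatible` -/

/-- **The transport law (binder `hT`)** for settings over embedded bases, modulo the extension of `Ψ^bs`: for the pin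
`E ≅ B^temp(φ)` with inverse `ψ` and a Galois `A ∈ Ob(C₁)` there is `c ∈ Π^tp_{X₂}` with `transportBaseAut_A(galoisSurj₁ g) =
galoisSurj₂(c·ψ(g)·c⁻¹)` for all `g` — gen 2's `galoisSurjOf_res`, read through `ι₂` (faithful) along
`Ψ^bs ⋙ ι₂ ≅ ι₁ ⋙ B^temp(φ)` and `c_A : Ψ^bs(A^bs) ≅ (Ψ A)^bs`. [cite: MochizukiEtTh2009, Thm 4.4 (i) p.320 (PDF p.94)] -/
theorem Thm44Hyp.transportBaseAut_galoisSurj_ofEmbedded [ι₂.Faithful] (h : Thm44Hyp S₁ S₂)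
    (hg₁ : ∀ (A : D₁) (hA : S₁.IsGaloisObj A), ∃ hA' : SemiGraphs.IsGaloisObj (ι₁.obj A),
      ∀ g : X₁.Pi, ι₁.map (S₁.galoisSurj A hA g).hom = (galoisSurjOf X₁.isTempered (ι₁.obj A) hA' g).hom)
    (hg₂ : ∀ (B : D₂) (hB : S₂.IsGaloisObj B), ∃ hB' : SemiGraphs.IsGaloisObj (ι₂.obj B),
      ∀ g : X₂.Pi, ι₂.map (S₂.galoisSurj B hB g).hom = (galoisSurjOf X₂.isTempered (ι₂.obj B) hB' g).hom)
    (φ : X₂.Pi →ₜ* X₁.Pi) (ψ : X₁.Pi →ₜ* X₂.Pi) (hφψ : ∀ y, φ (ψ y) = y)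
    (η : h.Ψbs.functor ⋙ ι₂ ≅ ι₁ ⋙ BTemp.res φ)
    (A : S₁.C) (hA : S₁.IsGaloisObj (S₁.base.obj A)) (hA₂ : S₂.IsGaloisObj (S₂.base.obj (h.Ψ.functor.obj A))) :
    ∃ c : X₂.Pi, ∀ g : X₁.Pi,
      h.transportBaseAut A (S₁.galoisSurj (S₁.base.obj A) hA g) =
        S₂.galoisSurj (S₂.base.obj (h.Ψ.functor.obj A)) hA₂ (c * ψ g * c⁻¹) := by
  have hφ : Function.Surjective φ := fun x => ⟨ψ x, hφψ x⟩
  obtain ⟨hA', e₁⟩ := hg₁ (S₁.base.obj A) hA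
  obtain ⟨hB', e₂⟩ := hg₂ (S₂.base.obj (h.Ψ.functor.obj A)) hA₂
  -- the component of `η` at `A^bs` with objectwise types, and its naturality on endomorphisms of `A^bs`
  obtain ⟨ηA, hn⟩ : ∃ ηA : ι₂.obj (h.Ψbs.functor.obj (S₁.base.obj A)) ≅ (BTemp.res φ).obj (ι₁.obj (S₁.base.obj A)),
      ∀ f : S₁.base.obj A ⟶ S₁.base.obj A,
        ι₂.map (h.Ψbs.functor.map f) ≫ ηA.hom = ηA.hom ≫ (BTemp.res φ).map (ι₁.map f) :=
    ⟨η.app (S₁.base.obj A), fun f => η.hom.naturality f⟩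
  let e : (BTemp.res φ).obj (ι₁.obj (S₁.base.obj A)) ≅ ι₂.obj (S₂.base.obj (h.Ψ.functor.obj A)) :=
    ηA.symm ≪≫ ι₂.mapIso (h.cmp A)
  have he_inv : e.inv = ι₂.map (h.cmp A).inv ≫ ηA.hom := rfl
  have he_hom : e.hom = ηA.inv ≫ ι₂.map (h.cmp A).hom := rfl
  obtain ⟨c₁, hc₁⟩ := galoisSurjOf_res X₁.isTempered X₂.isTempered φ hφ (ι₁.obj (S₁.base.obj A)) hA'
  obtain ⟨c₂, hc₂⟩ := galoisSurjOf_iso_conj X₂.isTempered e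
    (isGaloisObj_res X₁.isTempered φ hφ (ι₁.obj (S₁.base.obj A)) hA') hB'
  refine ⟨c₂ * c₁, fun g => ?_⟩
  apply Iso.ext
  apply ι₂.map_injective
  have hnat : ι₂.map (h.Ψbs.functor.map (S₁.galoisSurj (S₁.base.obj A) hA g).hom) =
      ηA.hom ≫ (BTemp.res φ).map (ι₁.map (S₁.galoisSurj (S₁.base.obj A) hA g).hom) ≫ ηA.inv := by
    rw [← Category.assoc, ← hn, Category.assoc, ηA.hom_inv_id, Category.comp_id]
  have h1 := hc₁ (ψ g)
  rw [hφψ] at h1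
  have h2 := hc₂ (c₁ * ψ g * c₁⁻¹)
  rw [show c₂ * (c₁ * ψ g * c₁⁻¹) * c₂⁻¹ = c₂ * c₁ * ψ g * (c₂ * c₁)⁻¹ by group, he_inv, he_hom] at h2
  rw [h.transportBaseAut_hom, Functor.map_comp, Functor.map_comp, e₂, hnat, e₁, h1, ← h2]
  simp only [Category.assoc]

/-- **T44-L09c `GaloisCompatible`** for settings over bases embedded in the temperoids, MODULO the extension `E` of
`Ψ^bs`: for every Galois `A ∈ Ob(C₁)`, `Ψ(A)` is Galois and `Aut_{D₁}(A^bs) ⥲ Aut_{D₂}((Ψ A)^bs)` carries `H_A^bs` onto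
`H_{Ψ A}^bs` — gen 2's `galoisCompatible_of` with `θ := φ⁻¹`, `hθ`, `hG`, `hT` all discharged from the pin `E ≅ B^temp(φ)`.
[cite: MochizukiEtTh2009, Thm 4.4 (i) p.320 (PDF p.94)] -/
theorem Thm44Hyp.galoisCompatible_ofEmbedded [ι₁.Faithful] [ι₂.Faithful] (h : Thm44Hyp S₁ S₂)
    (hg₁ : ∀ (A : D₁) (hA : S₁.IsGaloisObj A), ∃ hA' : SemiGraphs.IsGaloisObj (ι₁.obj A),
      ∀ g : X₁.Pi, ι₁.map (S₁.galoisSurj A hA g).hom = (galoisSurjOf X₁.isTempered (ι₁.obj A) hA' g).hom)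
    (hI₂ : ∀ B : D₂, SemiGraphs.IsGaloisObj (ι₂.obj B) → S₂.IsGaloisObj B)
    (hg₂ : ∀ (B : D₂) (hB : S₂.IsGaloisObj B), ∃ hB' : SemiGraphs.IsGaloisObj (ι₂.obj B),
      ∀ g : X₂.Pi, ι₂.map (S₂.galoisSurj B hB g).hom = (galoisSurjOf X₂.isTempered (ι₂.obj B) hB' g).hom)
    (E : BTemp X₁.Pi ≌ BTemp X₂.Pi) (ηE : h.Ψbs.functor ⋙ ι₂ ≅ ι₁ ⋙ E.functor) : h.GaloisCompatible := by
  haveI := X₁.secondCountableTopology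
  haveI := X₂.secondCountableTopology
  obtain ⟨φ, ψ, hψφ, hφψ, ⟨iφ⟩, -⟩ := BTemp.exists_res_iso_of_equivalence X₁.isTempered X₂.isTempered E
  let η : h.Ψbs.functor ⋙ ι₂ ≅ ι₁ ⋙ BTemp.res φ := ηE ≪≫ Functor.isoWhiskerLeft ι₁ iφ
  let θ : X₁.Pi ≃ₜ* X₂.Pi :=
    { toFun := ψ, invFun := φ, left_inv := hφψ, right_inv := hψφ, map_mul' := fun x y => map_mul ψ x y
      continuous_toFun := ψ.continuous, continuous_invFun := φ.continuous }
  have hθ : θ.toMulEquiv.symm.toMonoidHom = φ.toMonoidHom := MonoidHom.ext fun _ => rfl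
  have hθmap : S₁.Hodot.map θ.toMulEquiv.toMonoidHom = S₂.Hodot := by
    rw [Subgroup.map_equiv_eq_comap_symm', hθ]
    exact (h.hodot_eq_comap_ofEmbedded ι₁ ι₂ hg₁ hg₂ φ (fun x => ⟨ψ x, hφψ x⟩) η).symm
  exact h.galoisCompatible_of θ.toMulEquiv hθmap (h.isGalois_map_ofEmbedded ι₁ ι₂ hg₁ hI₂ E ηE) fun A hA =>
    h.transportBaseAut_galoisSurj_ofEmbedded ι₁ ι₂ hg₁ hg₂ φ ψ hφψ η A hA
      (h.isGalois_map_ofEmbedded ι₁ ι₂ hg₁ hI₂ E ηE A hA)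

/-! ### Consequences by name: T44-L08 and Thm. 4.4 (i) -/

/-- **T44-L08** for settings over embedded bases, modulo the extension of `Ψ^bs`: `Ψ` carries `H_{⊙,1}`-ample objects to
`H_{⊙,2}`-ample objects (abc-iut-L2-t3's `preservesAmple_of`). [cite: MochizukiEtTh2009, Thm 4.4 (i) p.320 (PDF p.94)] -/
theorem Thm44Hyp.preservesAmple_ofEmbedded [ι₁.Faithful] [ι₂.Faithful] (h : Thm44Hyp S₁ S₂)
    (hg₁ : ∀ (A : D₁) (hA : S₁.IsGaloisObj A), ∃ hA' : SemiGraphs.IsGaloisObj (ι₁.obj A),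
      ∀ g : X₁.Pi, ι₁.map (S₁.galoisSurj A hA g).hom = (galoisSurjOf X₁.isTempered (ι₁.obj A) hA' g).hom)
    (hI₂ : ∀ B : D₂, SemiGraphs.IsGaloisObj (ι₂.obj B) → S₂.IsGaloisObj B)
    (hg₂ : ∀ (B : D₂) (hB : S₂.IsGaloisObj B), ∃ hB' : SemiGraphs.IsGaloisObj (ι₂.obj B),
      ∀ g : X₂.Pi, ι₂.map (S₂.galoisSurj B hB g).hom = (galoisSurjOf X₂.isTempered (ι₂.obj B) hB' g).hom)
    (E : BTemp X₁.Pi ≌ BTemp X₂.Pi) (ηE : h.Ψbs.functor ⋙ ι₂ ≅ ι₁ ⋙ E.functor) : h.PreservesAmple :=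
  h.preservesAmple_of (h.galoisCompatible_ofEmbedded ι₁ ι₂ hg₁ hI₂ hg₂ E ηE)

/-- **Thm. 4.4 (i)** for settings over embedded bases from «`C₂` is a Frobenioid» ([FrdI] Thm. 5.2 (ii)), T44-L03
([FrdI] Thm. 3.4) and the extension `E` of `Ψ^bs` only (abc-iut-L2-t3's `thm44_i_of_inputs` with T44-L09c / T44-L09
discharged). [cite: MochizukiEtTh2009, Thm 4.4 (i) p.320 (PDF p.94)] -/
theorem Thm44Hyp.thm44_i_ofEmbedded [ι₁.Faithful] [ι₂.Faithful] (h : Thm44Hyp S₁ S₂)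
    (hg₁ : ∀ (A : D₁) (hA : S₁.IsGaloisObj A), ∃ hA' : SemiGraphs.IsGaloisObj (ι₁.obj A),
      ∀ g : X₁.Pi, ι₁.map (S₁.galoisSurj A hA g).hom = (galoisSurjOf X₁.isTempered (ι₁.obj A) hA' g).hom)
    (hI₂ : ∀ B : D₂, SemiGraphs.IsGaloisObj (ι₂.obj B) → S₂.IsGaloisObj B)
    (hg₂ : ∀ (B : D₂) (hB : S₂.IsGaloisObj B), ∃ hB' : SemiGraphs.IsGaloisObj (ι₂.obj B),
      ∀ g : X₂.Pi, ι₂.map (S₂.galoisSurj B hB g).hom = (galoisSurjOf X₂.isTempered (ι₂.obj B) hB' g).hom)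
    (E : BTemp X₁.Pi ≌ BTemp X₂.Pi) (ηE : h.Ψbs.functor ⋙ ι₂ ≅ ι₁ ⋙ E.functor)
    (hF₂ : PreFrobenioid.IsFrobenioid S₂.F) (h3 : h.PreservesFrobeniusStructure) : Thm44_i h :=
  h.thm44_i_of_inputs hF₂ h3 (h.galoisCompatible_ofEmbedded ι₁ ι₂ hg₁ hI₂ hg₂ E ηE)
    (h.hodotCompatible_ofEmbedded ι₁ ι₂ hg₁ hg₂ E ηE)

end OfEmbedded

end BiKummerSetting

end Literature.AnabelianGeometry.EtaleTheta

end
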